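import Summits.QuantumFields.BalabanUV.Beta.D1BFx.RoadEndRowPinned
import Summits.QuantumFields.BalabanUV.Beta.KernelWardRelativeEnd

/-!
# `BalabanUV.Beta.GAN24.WSlotParityBlind` — row G-an2-4, W-slot EXIT (α) of summit-lead RULING R-lead-g77-1 («use the identity, not its defect»),
# re-cut (α-0) at the CONSUMER: THE D1 END IS BLIND TO THE ROW-PARITY-ODD PART OF THE W-SLOT TABLE
# (OWNER gan24-p1, gen 33; design note `CTW-DESIGN-ALPHA-v0.md` v0.3 §2c ∕ §2d, interface requests IR-α0 ∕ IR-α0″)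

HONEST DEPENDENCY (page 1, mandatory): continuum YM on T⁴ ⇐ BetaPertH ∧ nine spine estimates (0/9 proved); BetaPertH ⇐ (D1) ∧ (D4) ∧
CAP+tail; G-an2-4 gates asym, D1 and NE2/3/4.  HONEST FRAMING (cell contract, verbatim): «discharging `BetaPertH` makes Bałaban's UV
stability UNCONDITIONAL — a real constructive-QFT result; it is NOT the continuum limit and NOT the Clay problem.»  THIS MODULE DISCHARGES
NOTHING of the wall: [folklore] bookkeeping BY NAME over an1's `KernelWardRelativeEnd.tadpole_eq_zero_of_parity`, an2's
`BubbleParity.trK_coDressKBmAt_KInvStep` ∕ `AxialDressingRooted.decays_coDressKBmAt_KInvStep`, an5's `TameKernelCalculus`, asym1's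
`HessKerFourFamily` ∕ `HessKerDressedLimit`, road FP's `RoadRebasedHoldsBm.exists_bm_rows_of_slots` and d1-formalise-leaf-03's
`D1BFx.RoadEndRowPinned`.  No `def`, no `Prop` minted, nothing printed asserted, 0 sorry; 0∕4 binders of row D1 instantiated; the S-∕W-slot rows
below are HYPOTHESES; NEVER «G-an2-4 closed» as (CONV-C); NOT D1, NOT `BetaPertH`, NOT continuum, NOT Clay.

ABSOLUTE RULE (cell charter, verbatim): «No internally-minted statement may enter as a cited fact. Every hypothesis is either kernel-proved in
this package or a verbatim quotation of a PUBLISHED theorem with page reference. The manuscript(s) under audit are NOT citable for their own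
disputed steps — they are the thing under adjudication; programme-internal (2001/route/tribunal) claims are never citable.»  Nothing is cited here.

## Why (context only; asserted nowhere below)

Summit-lead RULING R-lead-g77-1 (journal l.48491; FINAL by the row-D1 owner an2 g44, l.48730) records (β) «the W-slot (Q-R) for the dressed
literal at `d = 3` is NOT SUPPLIABLE by any entrywise scheme on gauge-variant pieces» and opens the EXIT (α) «use the identity, not its
defect».  The OWNER's design note (`CTW-DESIGN-ALPHA-v0.md` v0.3, RULING R-gan24p1-g32-1 l.48799 + A1 ∕ A2) located the cheapest re-cut
(α-0): the D1 consumer `D1BFx.RoadEndRowPinned.exists_allScalesSeq_JsRecBmAtOf_of_slots` reads the W-table `W_j μ 0 ν z` ONLY through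
`ExpKernelCalculus.hessKer G_j V_j W_j μ ν z = ½·tadpole G_j (W_j μ 0 ν z) − ½·bubble …`, `tadpole G W₂ = tr (G ∘ W₂)`, against the co-dressed
step resolvents `G_j = coDressKBmAt ρ Lc (KInvStep Lc j)`, which ARE sgn-symmetric (`trK G_j = sgnK G_j`, an2's `BubbleParity.trK_coDressKBmAt_KInvStep`)
and spread; and an1's `KernelWardRelativeEnd.tadpole_eq_zero_of_parity` says such a propagator has ZERO tadpole against every localised
ROW-PARITY-ODD table (`trK X = −sgnK X` — the (PAR) input class of the D1 lane's own remainder wall `SecondOrderStepRemainderWall`).  Engine study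
E41 (journal l.48673) found the literal's born Ward-defect letters' whole face charge in the kernel-transpose-ANTISYMMETRIC sector (the
commutator word) — for ff-valued letters exactly the parity-odd class.

## What is proved

* §1 (generic `d`) `loc_of_vertexFamily₂`; `tadpole_add_of_parityOdd` ∕ `tadpole_sub_of_parityOdd`: `tadpole G (W ± X) = tadpole G W` for `G`
  spread and sgn-symmetric, `W` localised, `X` localised parity-odd; `hessKer_add_of_parityOdd` ∕ `hessKer_sub_of_parityOdd`: for table
  FAMILIES `W`, `X` whose base-point slices `· μ 0 ν z` are localised, `X`'s parity-odd, `hessKer G V (W ± X) = hessKer G V W` (every `V`).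
* §2 (`d = 3`, any `Lc ≥ 1`, in-block root, an2's recursive block-mean family `SpineRooted.JsRecBmAtOf … W …`):
  `TbalOf_JsRecBmAtOf_codressedBm_sub_parityOdd(_unit)` — the four-family closed form with the W-table `W j − X j` in place of `W j`;
  **`exists_allScalesSeq_JsRecBmAtOf_of_slots_parity`** — `RoadEndRowPinned.exists_allScalesSeq_JsRecBmAtOf_of_slots` VERBATIM except that the
  W-slot rows `hW` ∕ `hWall` are asked of `unitW (sfStep Lc j) (smStep 3 Lc j) (W j − X j)` for ANY family `X` with localised parity-odd
  base-point slices; SAME conclusion `∃ κ θ, 0 ≤ θ < 1 ∧ AllScalesSeq (j ↦ secondMoment (TbalOf Lc (JsRecBmAtOf … W …) j) μ ν) κ θ` for the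
  UNMODIFIED family.
* §3 the literal of record (odd `Lc ≥ 2`, centred root, pins): `exists_allScalesSeq_JsRowD1_of_slots_parity`,
  **`exists_allScalesSeq_JsRowD1Pin_of_slots_parity`**, and the Cesàro reading `d1Drift_JsRowD1Pin_iff_cesaro_of_slots_parity`.
READING: the consumer-side answer to IR-α0 ∕ IR-α0″ is YES as a theorem — the D1 END accepts (hW, hWall) for `W⁰ − X` with `X` ANY localised
parity-odd family; what is NOT here: that the W-slot's divergent (DL) tower contribution IS such an `X` (IR-α0′ ∕ IR-α1, p2 ∕ an2; engine E42a).
Unit `b2b-balaban-gan24-p1` (gen 33), road CT-ROUTE ∕ CT-W of row G-an2-4; no existing file touched.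
-/

open Finset Filter Topology
open scoped BigOperators
open Literature.MathematicalPhysics.QuantumFieldTheory
open Literature.MathematicalPhysics.QuantumFieldTheory.Balaban1983to89
open Literature.MathematicalPhysics.QuantumFieldTheory.Balaban1983to89.Beta
open RemainderConstAllScales (AllScalesSeq)
open ExpKernelCalculus (MKer Decays BiLoc VertexFamily₂ hessKer tadpole)
open AffineAveraging (box toSite)
open AveragingContoursRooted (ctrOff ctrOff_mem_box)
open AveragingMixedJetTables (mixFFAt)
open OneStepResolventKernel (Fib LocStencil JetData)
open OneStepKernelFamily (vertexOfK KInvStep TbalOf D1Drift)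
open WilsonVertex2Sym (wsym22)
open HessKerDressedLimit (limMKerOf limStOf limTabOf decays_limMKerOf decays_sub_limMKerOf locStencil_limStOf locStencil_sub_limStOf
  vertexFamily₂_limTabOf vertexFamily₂_sub_limTabOf)
open Summit.QuantumFields.BalabanUV.Beta.TameKernelCalculus (Spr Loc trK tadpole_add)
open Summit.QuantumFields.BalabanUV.Beta.BorderedHessian (sgnK)
open Summit.QuantumFields.BalabanUV.Beta.BubbleParity (spr_of_decays trK_coDressKBmAt_KInvStep)
open Summit.QuantumFields.BalabanUV.Beta.KernelWardRelativeEnd (tadpole_eq_zero_of_parity)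
open Summit.QuantumFields.BalabanUV.Beta.HessKerDressedUnits (unitK unitS unitW)
open Summit.QuantumFields.BalabanUV.Beta.HessKerFourFamily (hessKer_four_unit allScalesSeq_secondMoment_TbalOf_four_lim)
open Summit.QuantumFields.BalabanUV.Beta.AxialDressingRooted (coDressKBmAt decays_coDressKBmAt_KInvStep)
open Summit.QuantumFields.BalabanUV.Beta.SpineRooted (JsRecBmAtOf JsRecWAtOf JsRecWAtOf_eq WrecAt)
open Summit.QuantumFields.BalabanUV.Beta.WardLocusRecursive (SrecAt)
open Summit.QuantumFields.BalabanUV.Beta.SecondOrderSocketIdentification (vh₂SAn1)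
open Summit.QuantumFields.BalabanUV.Beta.RowD1JointEnd (JsRowD1 JsRowD1Pin JsRowD1_eq JsRowD1Pin_eq)
open Summit.QuantumFields.BalabanUV.Beta.GAN24.CombesThomas (sfStep smStep sfStep_ne_zero smStep_ne_zero)
open Summit.QuantumFields.BalabanUV.Beta.FP.RoadRebasedHoldsBm (exists_bm_rows_of_slots)
open Summit.QuantumFields.BalabanUV.Beta.D1BFx.RoadEnd (d1Drift_iff_cesaro)
open Summit.QuantumFields.BalabanUV.Beta.D1BFx.RoadEndRowPinned (TbalOf_JsRecBmAtOf_codressedBm)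

namespace Summit.QuantumFields.BalabanUV.Beta.GAN24.WSlotParityBlind

noncomputable section

/-! ## §1 Generic `d`: the tadpole and the resolvent Hessian kernel are blind to localised parity-odd tables -/

section Generic

variable {d : ℕ}

/-- [folklore] A second-order vertex family at a positive radius has LOCALISED members (the `Loc` class of `TameKernelCalculus`). -/
theorem loc_of_vertexFamily₂ {W : Fin (d + 1) → (Fin (d + 1) → ℤ) → Fin (d + 1) → (Fin (d + 1) → ℤ) → MKer (d + 1) (Fib d)} {N : ℕ}
    {Cw δ : ℝ} (hW : VertexFamily₂ W N Cw δ) (hδ : 0 < δ) (μ : Fin (d + 1)) (y : Fin (d + 1) → ℤ) (ν : Fin (d + 1))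
    (y' : Fin (d + 1) → ℤ) : Loc (W μ y ν y') :=
  ⟨_, _, Cw, δ, hδ, hW μ y ν y'⟩

/-- [folklore] **THE TADPOLE IS BLIND TO A LOCALISED PARITY-ODD ADDEND**: `G` spread and sgn-symmetric (`trK G = sgnK G`), `W` localised, `X`
localised and row-parity-odd (`trK X = −sgnK X`) ⟹ `tadpole G (W + X) = tadpole G W` (`tadpole_add` ⨾ an1's `tadpole_eq_zero_of_parity`). -/
theorem tadpole_add_of_parityOdd {G W X : MKer (d + 1) (Fib d)} (hG : Spr G) (hGt : trK G = sgnK G) (hW : Loc W) (hX : Loc X)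
    (hXt : trK X = -sgnK X) : tadpole G (W + X) = tadpole G W := by
  rw [tadpole_add hG hW hX, tadpole_eq_zero_of_parity hG hGt hX hXt, add_zero]

/-- [folklore] **THE TADPOLE IS BLIND TO A LOCALISED PARITY-ODD SUBTRAHEND**: same data ⟹ `tadpole G (W − X) = tadpole G W`. -/
theorem tadpole_sub_of_parityOdd {G W X : MKer (d + 1) (Fib d)} (hG : Spr G) (hGt : trK G = sgnK G) (hW : Loc W) (hX : Loc X)
    (hXt : trK X = -sgnK X) : tadpole G (W - X) = tadpole G W := by
  have h := tadpole_add_of_parityOdd hG hGt (hW.sub hX) hX hXt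
  rw [sub_add_cancel] at h
  exact h.symm

/-- [folklore] **THE RESOLVENT HESSIAN KERNEL IS BLIND TO A PARITY-ODD ADDEND OF THE SECOND-ORDER TABLE**: for `G` spread and sgn-symmetric,
ANY first-order family `V`, and table families `W`, `X` whose base-point slices `W μ 0 ν z`, `X μ 0 ν z` are localised with `X`'s parity-odd,
`hessKer G V (W + X) = hessKer G V W` — `hessKer` reads the table only through `tadpole G (· μ 0 ν z)`. -/
theorem hessKer_add_of_parityOdd {G : MKer (d + 1) (Fib d)} (hG : Spr G) (hGt : trK G = sgnK G)
    (V : Fin (d + 1) → (Fin (d + 1) → ℤ) → MKer (d + 1) (Fib d))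
    {W X : Fin (d + 1) → (Fin (d + 1) → ℤ) → Fin (d + 1) → (Fin (d + 1) → ℤ) → MKer (d + 1) (Fib d)}
    (hW : ∀ μ ν z, Loc (W μ 0 ν z)) (hX : ∀ μ ν z, Loc (X μ 0 ν z)) (hXt : ∀ μ ν z, trK (X μ 0 ν z) = -sgnK (X μ 0 ν z)) :
    hessKer G V (W + X) = hessKer G V W := by
  funext μ ν z
  unfold ExpKernelCalculus.hessKer
  rw [show (W + X) μ 0 ν z = W μ 0 ν z + X μ 0 ν z from rfl, tadpole_add_of_parityOdd hG hGt (hW μ ν z) (hX μ ν z) (hXt μ ν z)]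

/-- [folklore] **THE RESOLVENT HESSIAN KERNEL IS BLIND TO A PARITY-ODD SUBTRAHEND OF THE SECOND-ORDER TABLE**: same data ⟹
`hessKer G V (W − X) = hessKer G V W`. -/
theorem hessKer_sub_of_parityOdd {G : MKer (d + 1) (Fib d)} (hG : Spr G) (hGt : trK G = sgnK G)
    (V : Fin (d + 1) → (Fin (d + 1) → ℤ) → MKer (d + 1) (Fib d))
    {W X : Fin (d + 1) → (Fin (d + 1) → ℤ) → Fin (d + 1) → (Fin (d + 1) → ℤ) → MKer (d + 1) (Fib d)}
    (hW : ∀ μ ν z, Loc (W μ 0 ν z)) (hX : ∀ μ ν z, Loc (X μ 0 ν z)) (hXt : ∀ μ ν z, trK (X μ 0 ν z) = -sgnK (X μ 0 ν z)) :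
    hessKer G V (W - X) = hessKer G V W := by
  funext μ ν z
  unfold ExpKernelCalculus.hessKer
  rw [show (W - X) μ 0 ν z = W μ 0 ν z - X μ 0 ν z from rfl, tadpole_sub_of_parityOdd hG hGt (hW μ ν z) (hX μ ν z) (hXt μ ν z)]

end Generic

/-! ## §2 `d = 3`: the recursive block-mean family — closed form and the all-scales END with the W-slot rows asked modulo a parity-odd family -/

section RecBm

variable {Lc : ℕ} [NeZero Lc] (hLc : 1 ≤ Lc) {r : Fin (3 + 1) → ℕ} (hr : r ∈ box (3 + 1) Lc) (cE cVH cΛ : ℝ)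
  (W : ℕ → Fin (3 + 1) → (Fin (3 + 1) → ℤ) → Fin (3 + 1) → (Fin (3 + 1) → ℤ) → MKer (3 + 1) (Fib 3))
  (Cw' δw : ℕ → ℝ) (hδw : ∀ j, 0 < δw j) (hW' : ∀ j, VertexFamily₂ (W j) Lc (Cw' j) (δw j))
  (X : ℕ → Fin (3 + 1) → (Fin (3 + 1) → ℤ) → Fin (3 + 1) → (Fin (3 + 1) → ℤ) → MKer (3 + 1) (Fib 3))
  (hX : ∀ j μ ν z, Loc (X j μ 0 ν z)) (hXt : ∀ j μ ν z, trK (X j μ 0 ν z) = -sgnK (X j μ 0 ν z))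
  {Cs cS δS θS Cw cW δW θW : ℝ}
include hX hXt

/-- [folklore] **THE FOUR-FAMILY CLOSED FORM OF an2's RECURSIVE BLOCK-MEAN FAMILY WITH THE W-TABLE READ MODULO ANY LOCALISED PARITY-ODD FAMILY**:
`TbalOf Lc (JsRecBmAtOf … W …) j = hessKer G_j (vertexOfK G_j Lc (SrecAt 3 Lc (toSite r) cE cVH cΛ j)) (W j − X j)`, `G_j = coDressKBmAt (toSite r) Lc (KInvStep Lc j)`
(`RoadEndRowPinned.TbalOf_JsRecBmAtOf_codressedBm` ⨾ §1, the co-dressed step resolvents being spread and sgn-symmetric by an2's theorems). -/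
theorem TbalOf_JsRecBmAtOf_codressedBm_sub_parityOdd (j : ℕ) :
    TbalOf Lc (JsRecBmAtOf hLc hr cE cVH cΛ W Cw' δw hδw hW') j =
      hessKer (coDressKBmAt (toSite r) Lc (KInvStep (d := 3) Lc j))
        (vertexOfK (coDressKBmAt (toSite r) Lc (KInvStep (d := 3) Lc j)) Lc (SrecAt 3 Lc (toSite r) cE cVH cΛ j)) (W j - X j) := by
  rw [TbalOf_JsRecBmAtOf_codressedBm hLc hr cE cVH cΛ W Cw' δw hδw hW' j]
  exact (hessKer_sub_of_parityOdd (spr_of_decays (decays_coDressKBmAt_KInvStep hr j)) (trK_coDressKBmAt_KInvStep hr j) _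
    (fun μ ν z => loc_of_vertexFamily₂ (hW' j) (hδw j) μ 0 ν z) (hX j) (hXt j)).symm

/-- [folklore] **THE SAME IN ANY NONZERO LEG UNITS** (`HessKerFourFamily.hessKer_four_unit`): the member `j` as a four-family form on the RESCALED
co-dressed resolvent, the rescaled undressed stencils `unitS_j (SrecAt … j)` and the rescaled REDUCED tables `unitW_j (W j − X j)`. -/
theorem TbalOf_JsRecBmAtOf_codressedBm_sub_parityOdd_unit (sf sm : ℕ → ℝ) (hsf : ∀ j, sf j ≠ 0) (hsm : ∀ j, sm j ≠ 0) (j : ℕ) :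
    TbalOf Lc (JsRecBmAtOf hLc hr cE cVH cΛ W Cw' δw hδw hW') j =
      hessKer (unitK (sf j) (sm j) (coDressKBmAt (toSite r) Lc (KInvStep (d := 3) Lc j)))
        (vertexOfK (unitK (sf j) (sm j) (coDressKBmAt (toSite r) Lc (KInvStep (d := 3) Lc j))) Lc
          (unitS (sf j) (sm j) (SrecAt 3 Lc (toSite r) cE cVH cΛ j)))
        (unitW (sf j) (sm j) (W j - X j)) := by
  rw [TbalOf_JsRecBmAtOf_codressedBm_sub_parityOdd hLc hr cE cVH cΛ W Cw' δw hδw hW' X hX hXt j]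
  exact (hessKer_four_unit (hsf j) (hsm j) Lc _ _ _ _).symm

/-- [folklore] **THE SCALAR ALL-SCALES BOUND OF THE STEP COEFFICIENTS OF THE RECURSIVE BLOCK-MEAN FAMILY FROM THE S-SLOT ROWS AND THE W-SLOT ROWS
MODULO ANY LOCALISED PARITY-ODD FAMILY** (`d = 3`, `2 ≤ Lc`, in-block root, adopted units `sfStep Lc` ∕ `smStep 3 Lc`): `RoadEndRowPinned`'s
`exists_allScalesSeq_JsRecBmAtOf_of_slots` VERBATIM, except that `hW` ∕ `hWall` are asked of the REDUCED tables `unitW_j (W j − X j)`, `X` ANY family with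
localised row-parity-odd base-point slices (`trK (X j μ 0 ν z) = −sgnK (X j μ 0 ν z)`) ⟹
`∃ κ θ, 0 ≤ θ < 1 ∧ AllScalesSeq (j ↦ secondMoment (TbalOf Lc (JsRecBmAtOf … W …) j) μ ν) κ θ` for the UNMODIFIED family.  K-side DISCHARGED (road FP's
`exists_bm_rows_of_slots`); scalar form = asym1's `allScalesSeq_secondMoment_TbalOf_four_lim` at the constructed limits.  The S-∕W-rows are HYPOTHESES. -/
theorem exists_allScalesSeq_JsRecBmAtOf_of_slots_parity (hLc2 : 2 ≤ Lc)
    (hS : ∀ j, LocStencil (unitS (sfStep Lc j) (smStep 3 Lc j) (SrecAt 3 Lc (toSite r) cE cVH cΛ j)) Cs δS)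
    (hSall : ∀ k j, LocStencil (unitS (sfStep Lc (k + j)) (smStep 3 Lc (k + j)) (SrecAt 3 Lc (toSite r) cE cVH cΛ (k + j)) -
      unitS (sfStep Lc k) (smStep 3 Lc k) (SrecAt 3 Lc (toSite r) cE cVH cΛ k)) (cS * θS ^ k) δS)
    (hW : ∀ j, VertexFamily₂ (unitW (sfStep Lc j) (smStep 3 Lc j) (W j - X j)) Lc Cw δW)
    (hWall : ∀ k j, VertexFamily₂ (unitW (sfStep Lc (k + j)) (smStep 3 Lc (k + j)) (W (k + j) - X (k + j)) -
      unitW (sfStep Lc k) (smStep 3 Lc k) (W k - X k)) Lc (cW * θW ^ k) δW)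
    (hδS : 0 < δS) (hδW : 0 < δW) (hθS0 : 0 ≤ θS) (hθS1 : θS < 1) (hθW0 : 0 ≤ θW) (hθW1 : θW < 1) (μ ν : Fin 4) :
    ∃ κ θ : ℝ, 0 ≤ θ ∧ θ < 1 ∧
      AllScalesSeq (fun j => B12Beta.secondMoment (TbalOf Lc (JsRecBmAtOf hLc hr cE cVH cΛ W Cw' δw hδw hW') j) μ ν) κ θ := by
  obtain ⟨C, δK, cK, θ, R, hR, hRK, hRS, hRW, hθ0, hθ1, hG, hGall, hSall', hWall'⟩ :=
    exists_bm_rows_of_slots (Lc := Lc) hLc2 hr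
      (S := fun j => unitS (sfStep Lc j) (smStep 3 Lc j) (SrecAt 3 Lc (toSite r) cE cVH cΛ j))
      (W := fun j => unitW (sfStep Lc j) (smStep 3 Lc j) (W j - X j)) hSall hWall hδS hδW hθS0 hθS1 hθW0 hθW1
  exact ⟨_, θ, hθ0, hθ1, allScalesSeq_secondMoment_TbalOf_four_lim (JsRecBmAtOf hLc hr cE cVH cΛ W Cw' δw hδw hW')
    (A := fun j => unitK (sfStep Lc j) (smStep 3 Lc j) (coDressKBmAt (toSite r) Lc (KInvStep (d := 3) Lc j)))
    (K := fun j => unitK (sfStep Lc j) (smStep 3 Lc j) (coDressKBmAt (toSite r) Lc (KInvStep (d := 3) Lc j)))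
    (S := fun j => unitS (sfStep Lc j) (smStep 3 Lc j) (SrecAt 3 Lc (toSite r) cE cVH cΛ j))
    (W := fun j => unitW (sfStep Lc j) (smStep 3 Lc j) (W j - X j))
    (Ainf := limMKerOf fun j => unitK (sfStep Lc j) (smStep 3 Lc j) (coDressKBmAt (toSite r) Lc (KInvStep (d := 3) Lc j)))
    (Kinf := limMKerOf fun j => unitK (sfStep Lc j) (smStep 3 Lc j) (coDressKBmAt (toSite r) Lc (KInvStep (d := 3) Lc j)))
    (Sinf := limStOf fun j => unitS (sfStep Lc j) (smStep 3 Lc j) (SrecAt 3 Lc (toSite r) cE cVH cΛ j))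
    (Winf := limTabOf fun j => unitW (sfStep Lc j) (smStep 3 Lc j) (W j - X j))
    (TbalOf_JsRecBmAtOf_codressedBm_sub_parityOdd_unit hLc hr cE cVH cΛ W Cw' δw hδw hW' X hX hXt (sfStep Lc) (smStep 3 Lc)
      sfStep_ne_zero smStep_ne_zero)
    hG (decays_limMKerOf hG hGall hθ1) (decays_sub_limMKerOf hGall hθ1)
    hG (decays_limMKerOf hG hGall hθ1) (decays_sub_limMKerOf hGall hθ1)
    hS (locStencil_limStOf hS hSall' hθ1) (locStencil_sub_limStOf hSall' hθ1)
    hW (vertexFamily₂_limTabOf hW hWall' hθ1) (vertexFamily₂_sub_limTabOf hWall' hθ1) hR hRK hRS hRW hθ0 hθ1 μ ν⟩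

end RecBm

/-! ## §3 The literal of record: the `hall` supplier with the (E)-family W-slot rows asked modulo a parity-odd family -/

section Record

variable {Lc : ℕ} [NeZero Lc] {Cs cS δS θS Cw cW δW θW : ℝ}
  (X : ℕ → Fin (3 + 1) → (Fin (3 + 1) → ℤ) → Fin (3 + 1) → (Fin (3 + 1) → ℤ) → MKer (3 + 1) (Fib 3))
  (hX : ∀ j μ ν z, Loc (X j μ 0 ν z)) (hXt : ∀ j μ ν z, trK (X j μ 0 ν z) = -sgnK (X j μ 0 ν z))
include hX hXt

/-- [folklore] **ROAD BF-x's `hall` ∕ `hθ0` ∕ `hθ1` BINDERS FOR THE LITERAL `JsRowD1 hLc N cΛ cB` FROM THE (E)-FAMILY S-SLOT ROWS AND THE W-SLOT ROWS MODULO ANY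
LOCALISED PARITY-ODD FAMILY `X`** (odd `Lc ≥ 2`, adopted units): the S-slot rows on `unitS_j (SrecAt 3 Lc ρ_c Lc⁴ (−Lc⁸∕2) cΛ j)` and the W-slot rows on
`unitW_j (WrecAt 3 Lc ρ_c … j − X j)` ⟹ `∃ κ θ, 0 ≤ θ < 1 ∧ AllScalesSeq (j ↦ secondMoment (TbalOf Lc (JsRowD1 …) j) μ ν) κ θ` — §2 at the centred root
(`RoadEndRowPinned.exists_allScalesSeq_JsRowD1_of_slots` is the case `X = 0`).  The rows are HYPOTHESES (row G-an2-4, family (E): not in the tree). -/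
theorem exists_allScalesSeq_JsRowD1_of_slots_parity (hLc : Odd Lc) (hL2 : 2 ≤ Lc) (N : ℕ) (cΛ cB : ℝ)
    (hS : ∀ j, LocStencil (unitS (sfStep Lc j) (smStep 3 Lc j)
      (SrecAt 3 Lc (toSite (ctrOff (3 + 1) Lc)) ((Lc : ℝ) ^ 4) (-((Lc : ℝ) ^ 8 / 2)) cΛ j)) Cs δS)
    (hSall : ∀ k j, LocStencil (unitS (sfStep Lc (k + j)) (smStep 3 Lc (k + j))
        (SrecAt 3 Lc (toSite (ctrOff (3 + 1) Lc)) ((Lc : ℝ) ^ 4) (-((Lc : ℝ) ^ 8 / 2)) cΛ (k + j)) -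
      unitS (sfStep Lc k) (smStep 3 Lc k) (SrecAt 3 Lc (toSite (ctrOff (3 + 1) Lc)) ((Lc : ℝ) ^ 4) (-((Lc : ℝ) ^ 8 / 2)) cΛ k)) (cS * θS ^ k) δS)
    (hW : ∀ j, VertexFamily₂ (unitW (sfStep Lc j) (smStep 3 Lc j)
      (WrecAt 3 Lc (toSite (ctrOff (3 + 1) Lc)) ((Lc : ℝ) ^ 4) (-((Lc : ℝ) ^ 8 / 2)) cΛ ((Lc : ℝ) ^ 8) cB ((8 * (N : ℝ) ^ 2)⁻¹ • wsym22 N)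
        (vh₂SAn1 Lc) (mixFFAt (toSite (ctrOff (3 + 1) Lc)) Lc) j - X j)) Lc Cw δW)
    (hWall : ∀ k j, VertexFamily₂ (unitW (sfStep Lc (k + j)) (smStep 3 Lc (k + j))
        (WrecAt 3 Lc (toSite (ctrOff (3 + 1) Lc)) ((Lc : ℝ) ^ 4) (-((Lc : ℝ) ^ 8 / 2)) cΛ ((Lc : ℝ) ^ 8) cB ((8 * (N : ℝ) ^ 2)⁻¹ • wsym22 N)
          (vh₂SAn1 Lc) (mixFFAt (toSite (ctrOff (3 + 1) Lc)) Lc) (k + j) - X (k + j)) -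
      unitW (sfStep Lc k) (smStep 3 Lc k)
        (WrecAt 3 Lc (toSite (ctrOff (3 + 1) Lc)) ((Lc : ℝ) ^ 4) (-((Lc : ℝ) ^ 8 / 2)) cΛ ((Lc : ℝ) ^ 8) cB ((8 * (N : ℝ) ^ 2)⁻¹ • wsym22 N)
          (vh₂SAn1 Lc) (mixFFAt (toSite (ctrOff (3 + 1) Lc)) Lc) k - X k)) Lc (cW * θW ^ k) δW)
    (hδS : 0 < δS) (hδW : 0 < δW) (hθS0 : 0 ≤ θS) (hθS1 : θS < 1) (hθW0 : 0 ≤ θW) (hθW1 : θW < 1) (μ ν : Fin 4) :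
    ∃ κ θ : ℝ, 0 ≤ θ ∧ θ < 1 ∧ AllScalesSeq (fun j => B12Beta.secondMoment (TbalOf Lc (JsRowD1 hLc N cΛ cB) j) μ ν) κ θ := by
  rw [JsRowD1_eq, JsRecWAtOf_eq]
  exact exists_allScalesSeq_JsRecBmAtOf_of_slots_parity hLc.pos (ctrOff_mem_box hLc.pos) _ _ _ _ _ _ _ _ X hX hXt hL2 hS hSall hW hWall
    hδS hδW hθS0 hθS1 hθW0 hθW1 μ ν

/-- [folklore] **ROAD BF-x's `hall` ∕ `hθ0` ∕ `hθ1` BINDERS FOR THE LITERAL OF RECORD `JsRowD1Pin hLc N` WITH THE W-SLOT ROWS ASKED MODULO ANY LOCALISED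
PARITY-ODD FAMILY `X`** (`cΛ := 2∕Lc⁴`, `cB := −Lc¹²∕4`; odd `Lc ≥ 2`): `∃ κ θ, 0 ≤ θ < 1 ∧ AllScalesSeq (j ↦ β⁰_j) κ θ`,
`β⁰_j := secondMoment (TbalOf Lc (JsRowD1Pin hLc N) j) μ ν`.  The (PAR)-socketed twin of `RoadEndRowPinned.exists_allScalesSeq_JsRowD1Pin_of_slots`
(its case `X = 0`) — CONDITIONAL on the four rows. -/
theorem exists_allScalesSeq_JsRowD1Pin_of_slots_parity (hLc : Odd Lc) (hL2 : 2 ≤ Lc) (N : ℕ)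
    (hS : ∀ j, LocStencil (unitS (sfStep Lc j) (smStep 3 Lc j)
      (SrecAt 3 Lc (toSite (ctrOff (3 + 1) Lc)) ((Lc : ℝ) ^ 4) (-((Lc : ℝ) ^ 8 / 2)) (2 / (Lc : ℝ) ^ 4) j)) Cs δS)
    (hSall : ∀ k j, LocStencil (unitS (sfStep Lc (k + j)) (smStep 3 Lc (k + j))
        (SrecAt 3 Lc (toSite (ctrOff (3 + 1) Lc)) ((Lc : ℝ) ^ 4) (-((Lc : ℝ) ^ 8 / 2)) (2 / (Lc : ℝ) ^ 4) (k + j)) -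
      unitS (sfStep Lc k) (smStep 3 Lc k)
        (SrecAt 3 Lc (toSite (ctrOff (3 + 1) Lc)) ((Lc : ℝ) ^ 4) (-((Lc : ℝ) ^ 8 / 2)) (2 / (Lc : ℝ) ^ 4) k)) (cS * θS ^ k) δS)
    (hW : ∀ j, VertexFamily₂ (unitW (sfStep Lc j) (smStep 3 Lc j)
      (WrecAt 3 Lc (toSite (ctrOff (3 + 1) Lc)) ((Lc : ℝ) ^ 4) (-((Lc : ℝ) ^ 8 / 2)) (2 / (Lc : ℝ) ^ 4) ((Lc : ℝ) ^ 8) (-((Lc : ℝ) ^ 12 / 4))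
        ((8 * (N : ℝ) ^ 2)⁻¹ • wsym22 N) (vh₂SAn1 Lc) (mixFFAt (toSite (ctrOff (3 + 1) Lc)) Lc) j - X j)) Lc Cw δW)
    (hWall : ∀ k j, VertexFamily₂ (unitW (sfStep Lc (k + j)) (smStep 3 Lc (k + j))
        (WrecAt 3 Lc (toSite (ctrOff (3 + 1) Lc)) ((Lc : ℝ) ^ 4) (-((Lc : ℝ) ^ 8 / 2)) (2 / (Lc : ℝ) ^ 4) ((Lc : ℝ) ^ 8) (-((Lc : ℝ) ^ 12 / 4))
          ((8 * (N : ℝ) ^ 2)⁻¹ • wsym22 N) (vh₂SAn1 Lc) (mixFFAt (toSite (ctrOff (3 + 1) Lc)) Lc) (k + j) - X (k + j)) -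
      unitW (sfStep Lc k) (smStep 3 Lc k)
        (WrecAt 3 Lc (toSite (ctrOff (3 + 1) Lc)) ((Lc : ℝ) ^ 4) (-((Lc : ℝ) ^ 8 / 2)) (2 / (Lc : ℝ) ^ 4) ((Lc : ℝ) ^ 8) (-((Lc : ℝ) ^ 12 / 4))
          ((8 * (N : ℝ) ^ 2)⁻¹ • wsym22 N) (vh₂SAn1 Lc) (mixFFAt (toSite (ctrOff (3 + 1) Lc)) Lc) k - X k)) Lc (cW * θW ^ k) δW)
    (hδS : 0 < δS) (hδW : 0 < δW) (hθS0 : 0 ≤ θS) (hθS1 : θS < 1) (hθW0 : 0 ≤ θW) (hθW1 : θW < 1) (μ ν : Fin 4) :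
    ∃ κ θ : ℝ, 0 ≤ θ ∧ θ < 1 ∧ AllScalesSeq (fun j => B12Beta.secondMoment (TbalOf Lc (JsRowD1Pin hLc N) j) μ ν) κ θ :=
  exists_allScalesSeq_JsRowD1_of_slots_parity X hX hXt hLc hL2 N _ _ hS hSall hW hWall hδS hδW hθS0 hθS1 hθW0 hθW1 μ ν

/-- [folklore] **FOR THE LITERAL OF RECORD THE WALL's TERM IS A CESÀRO STATEMENT ⟸ THE (E)-FAMILY S-SLOT ROWS ∧ THE W-SLOT ROWS MODULO ANY LOCALISED
PARITY-ODD FAMILY**: every channel `(μ, ν)`, every colour parameter `Nc`: `D1Drift Lc (JsRowD1Pin hLc N) Nc μ ν ⟺ (Σ_{j<m} β⁰_j)∕m → stepBal Nc Lc`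
(`RoadEnd.d1Drift_iff_cesaro` at the `hall` above).  The (PAR)-socketed twin of `RoadEndRowPinned.d1Drift_JsRowD1Pin_iff_cesaro_of_slots`. -/
theorem d1Drift_JsRowD1Pin_iff_cesaro_of_slots_parity (hLc : Odd Lc) (hL2 : 2 ≤ Lc) (N : ℕ)
    (hS : ∀ j, LocStencil (unitS (sfStep Lc j) (smStep 3 Lc j)
      (SrecAt 3 Lc (toSite (ctrOff (3 + 1) Lc)) ((Lc : ℝ) ^ 4) (-((Lc : ℝ) ^ 8 / 2)) (2 / (Lc : ℝ) ^ 4) j)) Cs δS)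
    (hSall : ∀ k j, LocStencil (unitS (sfStep Lc (k + j)) (smStep 3 Lc (k + j))
        (SrecAt 3 Lc (toSite (ctrOff (3 + 1) Lc)) ((Lc : ℝ) ^ 4) (-((Lc : ℝ) ^ 8 / 2)) (2 / (Lc : ℝ) ^ 4) (k + j)) -
      unitS (sfStep Lc k) (smStep 3 Lc k)
        (SrecAt 3 Lc (toSite (ctrOff (3 + 1) Lc)) ((Lc : ℝ) ^ 4) (-((Lc : ℝ) ^ 8 / 2)) (2 / (Lc : ℝ) ^ 4) k)) (cS * θS ^ k) δS)
    (hW : ∀ j, VertexFamily₂ (unitW (sfStep Lc j) (smStep 3 Lc j)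
      (WrecAt 3 Lc (toSite (ctrOff (3 + 1) Lc)) ((Lc : ℝ) ^ 4) (-((Lc : ℝ) ^ 8 / 2)) (2 / (Lc : ℝ) ^ 4) ((Lc : ℝ) ^ 8) (-((Lc : ℝ) ^ 12 / 4))
        ((8 * (N : ℝ) ^ 2)⁻¹ • wsym22 N) (vh₂SAn1 Lc) (mixFFAt (toSite (ctrOff (3 + 1) Lc)) Lc) j - X j)) Lc Cw δW)
    (hWall : ∀ k j, VertexFamily₂ (unitW (sfStep Lc (k + j)) (smStep 3 Lc (k + j))
        (WrecAt 3 Lc (toSite (ctrOff (3 + 1) Lc)) ((Lc : ℝ) ^ 4) (-((Lc : ℝ) ^ 8 / 2)) (2 / (Lc : ℝ) ^ 4) ((Lc : ℝ) ^ 8) (-((Lc : ℝ) ^ 12 / 4))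
          ((8 * (N : ℝ) ^ 2)⁻¹ • wsym22 N) (vh₂SAn1 Lc) (mixFFAt (toSite (ctrOff (3 + 1) Lc)) Lc) (k + j) - X (k + j)) -
      unitW (sfStep Lc k) (smStep 3 Lc k)
        (WrecAt 3 Lc (toSite (ctrOff (3 + 1) Lc)) ((Lc : ℝ) ^ 4) (-((Lc : ℝ) ^ 8 / 2)) (2 / (Lc : ℝ) ^ 4) ((Lc : ℝ) ^ 8) (-((Lc : ℝ) ^ 12 / 4))
          ((8 * (N : ℝ) ^ 2)⁻¹ • wsym22 N) (vh₂SAn1 Lc) (mixFFAt (toSite (ctrOff (3 + 1) Lc)) Lc) k - X k)) Lc (cW * θW ^ k) δW)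
    (hδS : 0 < δS) (hδW : 0 < δW) (hθS0 : 0 ≤ θS) (hθS1 : θS < 1) (hθW0 : 0 ≤ θW) (hθW1 : θW < 1) (μ ν : Fin 4) (Nc : ℝ) :
    D1Drift Lc (JsRowD1Pin hLc N) Nc μ ν ↔
      Tendsto (fun m : ℕ => (∑ j ∈ range m, B12Beta.secondMoment (TbalOf Lc (JsRowD1Pin hLc N) j) μ ν) / (m : ℝ)) atTop
        (𝓝 (B12Normalization.stepBal Nc Lc)) := by
  obtain ⟨κ, θ, hθ0, hθ1, hall⟩ := exists_allScalesSeq_JsRowD1Pin_of_slots_parity X hX hXt hLc hL2 N hS hSall hW hWall hδS hδW hθS0 hθS1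
    hθW0 hθW1 μ ν
  exact d1Drift_iff_cesaro _ hall hθ0 hθ1 Nc

end Record

end

end Summit.QuantumFields.BalabanUV.Beta.GAN24.WSlotParityBlind
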